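import Summits.Ventures.Crystal3D.Theorems.StickyWulffConstantGenericWallFloorAtOfLedger
import Summits.Ventures.Crystal3D.Theorems.StickyWulffConstantGenericWallFloorNonChainCriterion
import HarnessLib

/-!
# `GenericWallFloor` per pair for IRRATIONAL pairs, modulo `ExactOnly`(C12-55) and `StarPairCoaxial`
# (crux `GenericWallFloor`, line `WallLedgerG`)

HONEST FRAMING. Part of the venture `Summits/Ventures/Crystal3D` (cell `crystal3d-full`), helper `--supports` the
crux `GenericWallFloor` (stmt-Ventures-19480) of `route-Ventures-StickyWulffConstant`, registered line `WallLedgerG`,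
open stub `stub_twoSlabAdhesion` (general fillings).  One more instance of the per-pair capstone
`genericWallFloorAt_nonChain_of_star` (`…GenericWallFloorAtOfLedger`): 19480-p1's RATIONAL-FRAME family
`{G | ⟪A₁cᵢ, G cⱼ⟫ ∈ ℚ}` (`rationalFrame_self/_slot/_mirror`, `…NonChainCriterion`) is mirror-closed, contains `A₁`, and
avoids `A₂·Λ₀` as soon as ONE number `√2⟪A₁cᵢ, A₂w⟫` (`cᵢ` a cubic frame vector, `w` a slot) is irrational — all pairs
outside a countable family of relative orientations, in particular every non-chain pair in the measure sense.

* `genericWallFloorAt_irrational_of_star` — `GenericWallFloor`'s conclusion VERBATIM (c₀ = 1) for every such pair,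
  modulo exactly `ExactOnly`(C12-55) [E1] and `StarPairCoaxial` [certified as `StarPairFar`].

WHAT THIS IS NOT: not the crux (rational relative orientations include the ray-aligned chain core; the two named
inputs remain); F-C1 not moved.
-/

noncomputable section

namespace Summit.Ventures.Crystal3D.Theorems

open Summit.Ventures.Crystal3D Finset
open Literature.MathematicalPhysics.StatisticalMechanics (fccStacking barlowStacking IsHaggSeq contactDeficiency)
open scoped InnerProductSpace

open scoped Classical in
/-- **`GenericWallFloor` for every IRRATIONAL pair** (one irrational `√2⟪A₁cᵢ, A₂w⟫`), modulo `ExactOnly`(C12-55) and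
`StarPairCoaxial`. -/
theorem genericWallFloorAt_irrational_of_star
    {s₀ : EuclideanSpace ℝ (Fin 3)} (hs₀ : s₀ ∈ fccSlots)
    (hcert : ExactOnly 0 (fccSlots.filter fun w => 0 < ⟪w, s₀⟫_ℝ)) (hSP : StarPairCoaxial)
    (A₁ : EuclideanSpace ℝ (Fin 3) ≃ₗᵢ[ℝ] EuclideanSpace ℝ (Fin 3)) (t₁ : EuclideanSpace ℝ (Fin 3))
    (A₂ : EuclideanSpace ℝ (Fin 3) ≃ₗᵢ[ℝ] EuclideanSpace ℝ (Fin 3)) (t₂ : EuclideanSpace ℝ (Fin 3))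
    (hirr : ∃ i : Fin 3, ∃ w ∈ fccSlots, ∀ q : ℚ, Real.sqrt 2 * ⟪A₁ (cubicFrame i), A₂ w⟫_ℝ ≠ (q : ℝ)) :
    GenericWallFloorAt A₁ t₁ A₂ t₂ := by
  set 𝓕 : Set (EuclideanSpace ℝ (Fin 3) ≃ₗᵢ[ℝ] EuclideanSpace ℝ (Fin 3)) :=
    {G | ∀ i j : Fin 3, ∃ q : ℚ, ⟪A₁ (cubicFrame i), G (cubicFrame j)⟫_ℝ = (q : ℝ)} with h𝓕
  refine genericWallFloorAt_nonChain_of_star hs₀ hcert hSP A₁ t₁ A₂ t₂ 𝓕 (rationalFrame_self A₁) ?_ ?_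
  · -- avoidance: a slot of `A₂` inside a rational-frame lattice has rational `√2⟪A₁cᵢ, A₂w⟫`
    intro G hG heq
    obtain ⟨i, w, hw, hirr⟩ := hirr
    have hA₂w : A₂ w ∈ G '' fccStacking 1 (Real.sqrt (2 / 3)) := by
      rw [heq]; exact ⟨w, mem_fcc_of_mem_fccSlots hw, rfl⟩
    obtain ⟨y, hy, hyw⟩ := hA₂w
    have hy1 : ‖y‖ = 1 := by
      have := congrArg norm hyw
      rw [LinearIsometryEquiv.norm_map, LinearIsometryEquiv.norm_map, norm_eq_one_of_mem_fccSlots hw] at this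
      exact this
    obtain ⟨q, hq⟩ := rationalFrame_slot A₁ G hG i (mem_fccSlots_of_unit hy hy1)
    rw [hyw] at hq
    exact hirr q hq
  · -- closure under the twin reflections
    intro G hG m _ hmenu G' hG'
    exact rationalFrame_mirror A₁ G G' hG hmenu hG'

end Summit.Ventures.Crystal3D.Theorems

end
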